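import Literature.LinearAlgebra.Matrix.LatimerMacDuffeeCorrespondence
import Literature.LinearAlgebra.Matrix.CompanionMatrix
import HarnessLib

/-!
# TAUSSKY: under the Latimer–MacDuffee–Taussky correspondence the companion matrix of `f` is the
# principal class — `ℤⁿ_{C_f} ≅ ℤ[θ]`, and `A ∼ C_f` over `GLₙ(ℤ)` iff the ideal of `A` is principal

Topic `LinearAlgebra/Matrix`, namespace `Literature.LinearAlgebra.Matrix`; fourth file of the series
`LatimerMacDuffee.lean` / `LatimerMacDuffeeIdeal.lean` / `LatimerMacDuffeeCorrespondence.lean` (the module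
`ℤⁿ_A = QuotModule f A hA` of an integer matrix root `A` of `f`, `θ` acting as `v ↦ A v`; the bijection `Φ` between
the `GLₙ(ℤ)`-classes of matrix roots of `f` and the ideal classes of `S = ℤ[X]/(f) = AdjoinRoot f`, `Φ [A] = [J]`
whenever `ℤⁿ_A ≅ J`).  THEOREMS ONLY: no definition, no instance, no notation, no named fact (net Literature debt
`0`); the companion matrix is the tree's `Literature.LinearAlgebra.Matrix.companion` of `CompanionMatrix.lean`
(HORN–JOHNSON (3.3.12): ones on the subdiagonal, last column `-(f₀, …, f_{n-1})`), applied to the coefficient vector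
`i ↦ f.coeff i` of `f`.

## Sources, VERBATIM

O. Taussky, *A result concerning classes of matrices*, J. Number Theory 6 (1974) 64–71 [Taussky1974], §1, p. 64
(held `paper:doi-10-1016-0022-314x-74-90009-2`, chunk p0001): "The `n × n` matrices `A` considered here have
rational integral elements […] and irreducible characteristic polynomials `f(x)` over the ring `Z` of rational
integers. By the class of `A` is understood the set `{S⁻¹AS}` where `S` is any unimodular `Z`-matrix `n × n`. Let
`α` be an algebraic integer for which `f(α) = 0`. It is known that the matrix classes corresponding to `f(x)` are in
1-1 correspondence with the ideal classes in the order `Z[α]` […] (1) Let `A` be a `Z`-matrix root of degree `n` of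
`f(x) = 0`. Then `α` is a characteristic root of `A` and the corresponding vector can be chosen to be a `Z`-basis for
an ideal in `Z[α]`. The ideal class of this ideal corresponds to the matrix class determined by `A`. In this
correspondence the principal class in `Z[α]` corresponds to the class of the companion matrix and the class of the
transposed matrix corresponds to the complementary ideal class."  §4 (I), p. 68: "If `1, α, …, αⁿ⁻¹` is the basis,
then the companion matrix `C` has these `n` elements as an eigenvector".

H. Endo, K. Iwaki, A. Pajitnov, *Cappell-Shaneson knot pairs with the same Alexander polynomial*, arXiv:2604.01045
(2026) [EndoIwakiPajitnov2026] (held `paper:arxiv-2604.01045`), §3 Thm. 3.4 (chunk p0006): "Theorem 3.4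
(Latimer-MacDuffee, Taussky). Let `f(x) ∈ ℤ[x]` be an irreducible monic polynomial. Let `θ` be a root of `f(x)`.
The following two maps are bijective and `φ_f⁻¹ = ψ_f`. […] Let `{v₁, …, vₙ}` be a basis of an ideal `S` and
`v = [v₁, …, vₙ]ᵀ`. There is `A ∈ M(n;ℤ)` such that `θ v = A v`. Define `ψ_f : C(ℤ[θ]) → {A ∈ M(n;ℤ) ∣ f(A) = O}/∼_C`
as `ψ_f([S]) = [A]`." and the remark after Cor. 3.12 (chunk p0007): "matrices corresponding to non-invertible ideal
classes are not `*`-equivalent to companion matrices. Companion matrices correspond to the identity element by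
Theorem 3.4 and it is trivially invertible."

O. Taussky, *On a theorem of Latimer and MacDuffee*, Canad. J. Math. 1 (1949) 300–302 [Taussky1949], Theorems 1–4
(the correspondence itself, as formalised in the three earlier files).

CONVENTIONS.  The printed correspondence attaches to `A` the ideal spanned by an EIGENVECTOR `v ∈ ℤ[θ]ⁿ`,
`A v = θ v`, i.e. `θ vᵢ = Σⱼ Aᵢⱼ vⱼ` (rows); the tree's `Φ` attaches to `A` the module `ℤⁿ_A` with `θ` acting on
columns, so the printed class of `A` is the tree's `Φ [Aᵀ]`.  Accordingly TAUSSKY's companion matrix («`C` has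
`1, α, …, αⁿ⁻¹` as an eigenvector», rows) is the transpose of HORN–JOHNSON's `companion` (columns: `C eⱼ = e_{j+1}`),
and her statement «the principal class corresponds to the class of the companion matrix» is, in the tree's
conventions, EXACTLY `Φ [companion (f.coeff ·)] = [(1)]` — §2–§3 below.

## What is formalised

`f ∈ ℤ[X]` monic of degree `n` (`[Fact f.Monic]`, `hdeg : f.natDegree = n`), `S = AdjoinRoot f`, `θ = AdjoinRoot.root f`,
`C_f = companion (fun i : Fin n ↦ f.coeff i)`.

* §1 `aeval_companion_coeff_eq_zero` (`f(C_f) = 0`: the companion matrix is a matrix root of `f`),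
  `root_mul_root_pow_eq_sum_companion` (`θ · θʲ = Σᵢ (C_f)ᵢⱼ θⁱ`: `C_f` is the matrix of multiplication by `θ` on the
  power basis `1, θ, …, θⁿ⁻¹`).
* §2 **`QuotModule.nonempty_linearEquiv_companion`** (`ℤⁿ_{C_f} ≅ S` as `S`-modules, by `v ↦ Σ vᵢ θⁱ` — TAUSSKY's
  «the principal class in `Z[α]` corresponds to the class of the companion matrix»),
  `QuotModule.nonempty_linearEquiv_companion_top` (`≅ (1) = ⊤`, the form consumed by the correspondence `Φ`),
  `apply_companion_eq_top` (every bijection `Φ` of `exists_equiv_quot_conj_quot_idealClass` has `Φ [C_f] = [(1)]`).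
* §3 **`QuotModule.nonempty_linearEquiv_self_iff_exists_conj_companion`** (`ℤⁿ_A ≅ S ⟺ A ∼ C_f`),
  **`QuotModule.exists_conj_companion_iff_isPrincipal`** (for `ℤⁿ_A ≅ J`: `A ∼ C_f ⟺ J` is principal),
  `QuotModule.exists_conj_companion_iff_idealClass_top` (`⟺ (x)J = (y)(1)` for some `x, y ≠ 0`).
* §4 **`forall_exists_conj_companion_iff_isPrincipalIdealRing`** (EVERY matrix root of `f` is `GLₙ(ℤ)`-conjugate
  to the companion matrix iff `ℤ[θ]` is a principal ideal ring — the class-number-one theorem of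
  `LatimerMacDuffee.lean` with its canonical representative), `forall_charpoly_exists_conj_companion_iff_isPrincipalIdealRing`
  (the same for the integer matrices with characteristic polynomial `f`), `exists_conj_companion_of_isPrincipalIdealRing`.
-/

open Polynomial

noncomputable section

namespace Literature.LinearAlgebra.Matrix

variable {n : ℕ}

/-! ### §1 The companion matrix of `f` is a matrix root of `f`, and is the matrix of `θ` on `1, θ, …, θⁿ⁻¹` -/

section Companion

variable {f : ℤ[X]}

/-- A monic `f` of degree `n` is `Xⁿ + Σ_{i<n} fᵢ Xⁱ`, the sum taken over `Fin n`. [folklore] -/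
private theorem eq_X_pow_add_sum_coeff (hf : f.Monic) (hdeg : f.natDegree = n) :
    f = X ^ n + ∑ i : Fin n, C (f.coeff i) * X ^ (i : ℕ) := by
  conv_lhs => rw [hf.as_sum, hdeg]
  rw [Fin.sum_univ_eq_sum_range (fun i ↦ C (f.coeff i) * X ^ i) n]

/-- **The companion matrix of `f` is a matrix root of `f`: `f(C_f) = 0`** (`C_f` = the companion matrix of the
monic `f = Xⁿ + f_{n-1}Xⁿ⁻¹ + ⋯ + f₀`, ones on the subdiagonal and last column `-(f₀, …, f_{n-1})`; HORN–JOHNSON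
Thm. 3.3.14 as in the tree's `aeval_companion_eq_zero`), so that `C_f` has a class under the correspondence.
[cite: Taussky1974, §1, p. 64 («the class of the companion matrix»)] [cite: EndoIwakiPajitnov2026, §3, remark
after Cor. 3.12 («Companion matrices correspond to the identity element by Theorem 3.4»)] -/
theorem aeval_companion_coeff_eq_zero (hf : f.Monic) (hdeg : f.natDegree = n) :
    aeval (companion fun i : Fin n ↦ f.coeff i) f = 0 := by
  have h := aeval_companion_eq_zero (R := ℤ) (fun i : Fin n ↦ f.coeff i)
  rwa [← eq_X_pow_add_sum_coeff hf hdeg] at h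

/-- `θⁿ = -(f₀ + f₁ θ + ⋯ + f_{n-1} θⁿ⁻¹)` in `ℤ[θ] = ℤ[X]/(f)`. [folklore] -/
private theorem root_pow_eq_sum_neg_coeff (hf : f.Monic) (hdeg : f.natDegree = n) :
    AdjoinRoot.root f ^ n = ∑ i : Fin n, ((-f.coeff i : ℤ) : AdjoinRoot f) * AdjoinRoot.root f ^ (i : ℕ) := by
  have h0 : aeval (AdjoinRoot.root f) (X ^ n + ∑ i : Fin n, C (f.coeff i) * X ^ (i : ℕ)) = 0 := by
    rw [← eq_X_pow_add_sum_coeff hf hdeg, AdjoinRoot.aeval_eq, AdjoinRoot.mk_self]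
  simp only [map_add, map_pow, aeval_X, map_sum, map_mul, map_intCast, eq_intCast] at h0
  rw [eq_neg_of_add_eq_zero_left h0, ← Finset.sum_neg_distrib]
  refine Finset.sum_congr rfl fun i _ ↦ ?_
  push_cast
  ring

/-- **`C_f` is the matrix of multiplication by `θ` on the power basis: `θ · θʲ = Σᵢ (C_f)ᵢⱼ θⁱ`** (`j < n`; for
`j + 1 < n` this is `θʲ⁺¹`, for `j = n - 1` it is `θⁿ = -Σ fᵢ θⁱ`) — the column form of TAUSSKY's «if `1, α, …, αⁿ⁻¹`
is the basis, then the companion matrix has these `n` elements as an eigenvector» (her companion matrix acts on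
rows, i.e. is the transpose of HORN–JOHNSON's). [cite: Taussky1974, §4 (I), p. 68] -/
theorem root_mul_root_pow_eq_sum_companion (hf : f.Monic) (hdeg : f.natDegree = n) (j : Fin n) :
    AdjoinRoot.root f * AdjoinRoot.root f ^ (j : ℕ) =
      ∑ i : Fin n, ((companion (fun i : Fin n ↦ f.coeff i) i j : ℤ) : AdjoinRoot f) *
        AdjoinRoot.root f ^ (i : ℕ) := by
  by_cases hj : (j : ℕ) + 1 = n
  · simp_rw [companion_apply, if_pos hj]
    rw [← pow_succ', hj]
    exact root_pow_eq_sum_neg_coeff hf hdeg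
  · have hj' : (j : ℕ) + 1 < n := lt_of_le_of_ne (Nat.succ_le_of_lt j.2) hj
    simp_rw [companion_apply, if_neg hj]
    rw [Finset.sum_eq_single (⟨(j : ℕ) + 1, hj'⟩ : Fin n)]
    · rw [if_pos rfl, Int.cast_one, one_mul, pow_succ']
    · intro i _ hi
      rw [if_neg (fun h ↦ hi (Fin.ext h)), Int.cast_zero, zero_mul]
    · exact fun h ↦ absurd (Finset.mem_univ _) h

/-- If `ℤ[X]/(f)` is nontrivial (e.g. a domain) then `deg f ≠ 0` (a monic `f` of degree `0` is `1`). [folklore] -/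
private theorem natDegree_ne_zero_of_nontrivial [Fact f.Monic] [Nontrivial (AdjoinRoot f)] : f.natDegree ≠ 0 := by
  intro h
  have hf : f.Monic := Fact.out
  have h1 : f = 1 := Polynomial.eq_one_of_monic_natDegree_zero hf h
  have h2 : (AdjoinRoot.mk f) (1 : ℤ[X]) = 0 := by
    rw [← h1]
    exact AdjoinRoot.mk_self
  rw [map_one] at h2
  exact one_ne_zero h2

end Companion

/-! ### §2 `ℤⁿ_{C_f} ≅ ℤ[θ]`: the companion matrix lies in the principal class -/

namespace QuotModule

section Principal

variable {f : ℤ[X]} [Fact f.Monic]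

/-- **TAUSSKY: «the principal class in `Z[α]` corresponds to the class of the companion matrix» — `ℤⁿ_{C_f} ≅ ℤ[θ]`
as `ℤ[θ]`-modules**, for `f ∈ ℤ[X]` monic of degree `n` and `C_f` its companion matrix: the map `v ↦ Σᵢ vᵢ θⁱ` is
`ℤ[θ]`-linear (`θ · θʲ = Σᵢ (C_f)ᵢⱼ θⁱ`, §1, i.e. `C_f` is the matrix of `θ` on the power basis) and bijective
(`1, θ, …, θⁿ⁻¹` is a `ℤ`-basis of `ℤ[θ]`). [cite: Taussky1974, §1, p. 64 and §4 (I), p. 68]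
[cite: EndoIwakiPajitnov2026, §3 Thm. 3.4 and the remark after Cor. 3.12] -/
theorem nonempty_linearEquiv_companion (hdeg : f.natDegree = n)
    (hC : aeval (companion fun i : Fin n ↦ f.coeff i) f = 0) :
    Nonempty (QuotModule f (companion fun i : Fin n ↦ f.coeff i) hC ≃ₗ[AdjoinRoot f] AdjoinRoot f) := by
  have hf : f.Monic := Fact.out
  let bS : Module.Basis (Fin n) ℤ (AdjoinRoot f) := (AdjoinRoot.powerBasis' hf).basis.reindex (finCongr hdeg)
  have hbS : ∀ i : Fin n, bS i = AdjoinRoot.root f ^ (i : ℕ) := fun i ↦ by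
    simp [bS, Module.Basis.reindex_apply, PowerBasis.coe_basis, AdjoinRoot.powerBasis'_gen]
  let T : QuotModule f (companion fun i : Fin n ↦ f.coeff i) hC →ₗ[AdjoinRoot f] AdjoinRoot f :=
    toRing (hA := hC) (fun j : Fin n ↦ AdjoinRoot.root f ^ (j : ℕ)) (root_mul_root_pow_eq_sum_companion hf hdeg)
  have hT : ∀ v, T (of f _ hC v) = bS.equivFun.symm v := fun v ↦ by
    simp only [T, toRing_of, Module.Basis.equivFun_symm_apply, hbS, zsmul_eq_mul]
  refine ⟨LinearEquiv.ofBijective T ⟨fun x y hxy ↦ ?_, fun s ↦ ?_⟩⟩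
  · obtain ⟨v, rfl⟩ := (of f _ hC).surjective x
    obtain ⟨w, rfl⟩ := (of f _ hC).surjective y
    rw [hT, hT] at hxy
    rw [bS.equivFun.symm.injective hxy]
  · refine ⟨of f _ hC (bS.equivFun s), ?_⟩
    rw [hT, LinearEquiv.symm_apply_apply]

/-- **`ℤⁿ_{C_f} ≅ (1)`, the unit ideal of `ℤ[θ]`** (§2 composed with `S ≅ ⊤`): the form in which the correspondence
`Φ` (`Φ [A] = [J]` whenever `ℤⁿ_A ≅ J`) consumes TAUSSKY's statement. [cite: Taussky1974, §1, p. 64]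
[cite: EndoIwakiPajitnov2026, §3, remark after Cor. 3.12] -/
theorem nonempty_linearEquiv_companion_top (hdeg : f.natDegree = n)
    (hC : aeval (companion fun i : Fin n ↦ f.coeff i) f = 0) :
    Nonempty (QuotModule f (companion fun i : Fin n ↦ f.coeff i) hC ≃ₗ[AdjoinRoot f] (⊤ : Ideal (AdjoinRoot f))) :=
  let ⟨e⟩ := nonempty_linearEquiv_companion hdeg hC
  ⟨e.trans (Submodule.topEquiv (R := AdjoinRoot f) (M := AdjoinRoot f)).symm⟩

end Principal

/-! ### §3 `A ∼ C_f` over `GLₙ(ℤ)` iff `ℤⁿ_A ≅ ℤ[θ]` iff the ideal of `A` is principal -/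

section Classes

variable {f : ℤ[X]} [Fact f.Monic] {A : _root_.Matrix (Fin n) (Fin n) ℤ} {hA : aeval A f = 0}

/-- **`ℤⁿ_A ≅ ℤ[θ]` iff `A` is `GLₙ(ℤ)`-conjugate to the companion matrix** (`P A = C_f P` with `det P = ±1`):
by §2 `ℤ[θ] ≅ ℤⁿ_{C_f}`, and `ℤⁿ_A ≅ ℤⁿ_B` iff `A ∼ B` (TAUSSKY's Theorems 2–3, the tree's
`exists_isUnit_det_of_linearEquiv` / `linearEquivOfConj`). [cite: Taussky1974, §1, p. 64]
[cite: Taussky1949, Theorems 2–3] -/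
theorem nonempty_linearEquiv_self_iff_exists_conj_companion (hdeg : f.natDegree = n)
    (hC : aeval (companion fun i : Fin n ↦ f.coeff i) f = 0) :
    Nonempty (QuotModule f A hA ≃ₗ[AdjoinRoot f] AdjoinRoot f) ↔
      ∃ P : _root_.Matrix (Fin n) (Fin n) ℤ, IsUnit P.det ∧ P * A = companion (fun i : Fin n ↦ f.coeff i) * P := by
  obtain ⟨eC⟩ := nonempty_linearEquiv_companion hdeg hC
  constructor
  · rintro ⟨e⟩
    exact exists_isUnit_det_of_linearEquiv (e.trans eC.symm)
  · rintro ⟨P, hPdet, hP⟩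
    exact ⟨(linearEquivOfConj (hA := hA) (hB := hC) P hPdet hP).trans eC⟩

variable [IsDomain (AdjoinRoot f)]

/-- **TAUSSKY: the class of the companion matrix is the principal class** — if `ℤⁿ_A ≅ J` for an ideal `J` of
`ℤ[θ]`, then `A` is `GLₙ(ℤ)`-conjugate to `C_f` iff `J` is principal (`⟹`: `J ≅ ℤⁿ_A ≅ ℤ[θ]`, and an ideal
isomorphic to the ring is generated by the image of `1`; `⟸`: `J = (a)` with `a ≠ 0` — `J ≠ 0` because `ℤⁿ_A ≠ 0`,
`n = deg f ≥ 1` for a domain `ℤ[θ]` — so `J ≅ ℤ[θ]` by `x ↦ xa`). [cite: Taussky1974, §1, p. 64]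
[cite: EndoIwakiPajitnov2026, §3, remark after Cor. 3.12 («matrices corresponding to non-invertible ideal classes are
not *-equivalent to companion matrices. Companion matrices correspond to the identity element»)] -/
theorem exists_conj_companion_iff_isPrincipal (hdeg : f.natDegree = n)
    (hC : aeval (companion fun i : Fin n ↦ f.coeff i) f = 0) {J : Ideal (AdjoinRoot f)}
    (e : QuotModule f A hA ≃ₗ[AdjoinRoot f] J) :
    (∃ P : _root_.Matrix (Fin n) (Fin n) ℤ, IsUnit P.det ∧ P * A = companion (fun i : Fin n ↦ f.coeff i) * P) ↔
      J.IsPrincipal := by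
  rw [← nonempty_linearEquiv_self_iff_exists_conj_companion (hA := hA) hdeg hC]
  constructor
  · rintro ⟨e'⟩
    exact ⟨⟨_, ideal_eq_span_of_linearEquiv (e'.symm.trans e)⟩⟩
  · rintro ⟨⟨a, ha⟩⟩
    have hn : n ≠ 0 := hdeg ▸ natDegree_ne_zero_of_nontrivial (f := f)
    have ha0 : a ≠ 0 := by
      rintro rfl
      have hJ : J = ⊥ := by rw [ha]; simp
      have h1 : (of f A hA (Pi.single ⟨0, Nat.pos_of_ne_zero hn⟩ 1) : QuotModule f A hA) ≠ 0 :=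
        of_ne_zero (by simp)
      apply h1
      have h2 : (e (of f A hA (Pi.single ⟨0, Nat.pos_of_ne_zero hn⟩ 1)) : AdjoinRoot f) = 0 := by
        have h3 : (e (of f A hA (Pi.single ⟨0, Nat.pos_of_ne_zero hn⟩ 1)) : AdjoinRoot f) ∈
            (⊥ : Ideal (AdjoinRoot f)) := by
          rw [← hJ]
          exact (e (of f A hA (Pi.single ⟨0, Nat.pos_of_ne_zero hn⟩ 1))).2
        exact (Submodule.mem_bot _).1 h3
      exact e.injective (Subtype.ext (h2.trans (by rw [map_zero]; rfl)))
    have eJ : J ≃ₗ[AdjoinRoot f] AdjoinRoot f :=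
      (LinearEquiv.ofEq _ _ ha).trans (LinearEquiv.toSpanNonzeroSingleton (AdjoinRoot f) (AdjoinRoot f) a ha0).symm
    exact ⟨e.trans eJ⟩

/-- The same in the language of ideal classes `(x)I = (y)J`: if `ℤⁿ_A ≅ J ≠ 0` then `A ∼ C_f` iff `J` lies in the
class of the unit ideal `(1)` («the identity element is the class of principal ideals», the tree's
`idealClass_top_iff_isPrincipal`). [cite: Taussky1974, §1, p. 64] [cite: EndoIwakiPajitnov2026, §3 Thm. 3.4 and the
remark after Cor. 3.12] -/
theorem exists_conj_companion_iff_idealClass_top (hdeg : f.natDegree = n)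
    (hC : aeval (companion fun i : Fin n ↦ f.coeff i) f = 0) {J : Ideal (AdjoinRoot f)} (hJ : J ≠ ⊥)
    (e : QuotModule f A hA ≃ₗ[AdjoinRoot f] J) :
    (∃ P : _root_.Matrix (Fin n) (Fin n) ℤ, IsUnit P.det ∧ P * A = companion (fun i : Fin n ↦ f.coeff i) * P) ↔
      ∃ x y : AdjoinRoot f, x ≠ 0 ∧ y ≠ 0 ∧ Ideal.span {x} * J = Ideal.span {y} * ⊤ := by
  rw [exists_conj_companion_iff_isPrincipal hdeg hC e, idealClass_top_iff_isPrincipal hJ]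

end Classes

end QuotModule

/-! ### §2 (continued) `Φ [C_f] = [(1)]` for the correspondence `Φ` -/

section Correspondence

variable {f : ℤ[X]} [Fact f.Monic] [IsDomain (AdjoinRoot f)]

/-- **`Φ [C_f] = [(1)]`**: every class map `Φ` with `Φ [A] = [J]` whenever `ℤⁿ_A ≅ J` — in particular the bijection of
`exists_equiv_quot_conj_quot_idealClass` — sends the class of the companion matrix to the class of the unit ideal,
TAUSSKY's «the principal class in `Z[α]` corresponds to the class of the companion matrix» / ENDO–IWAKI–PAJITNOV's
«Companion matrices correspond to the identity element». [cite: Taussky1974, §1, p. 64]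
[cite: EndoIwakiPajitnov2026, §3, remark after Cor. 3.12] -/
theorem apply_companion_eq_top (hdeg : f.natDegree = n)
    (hC : aeval (companion fun i : Fin n ↦ f.coeff i) f = 0) {β : Type*}
    {Φ : Quot (fun A B : {A : _root_.Matrix (Fin n) (Fin n) ℤ // aeval A f = 0} ↦
        ∃ P : _root_.Matrix (Fin n) (Fin n) ℤ, IsUnit P.det ∧ P * A.1 = B.1 * P) → β}
    {Ψ : {J : Ideal (AdjoinRoot f) // J ≠ ⊥} → β}
    (hΦ : ∀ (A : _root_.Matrix (Fin n) (Fin n) ℤ) (hA : aeval A f = 0) (J : Ideal (AdjoinRoot f)) (hJ : J ≠ ⊥),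
      Nonempty (QuotModule f A hA ≃ₗ[AdjoinRoot f] J) → Φ (Quot.mk _ ⟨A, hA⟩) = Ψ ⟨J, hJ⟩) :
    Φ (Quot.mk _ ⟨companion (fun i : Fin n ↦ f.coeff i), hC⟩) = Ψ ⟨⊤, top_ne_bot⟩ :=
  hΦ _ hC ⊤ top_ne_bot (QuotModule.nonempty_linearEquiv_companion_top hdeg hC)

end Correspondence

/-! ### §4 Every matrix root of `f` is conjugate to the companion matrix iff `ℤ[θ]` is a principal ideal ring -/

section ClassNumberOne

variable {f : ℤ[X]} [Fact f.Monic] [IsDomain (AdjoinRoot f)]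

/-- **Class number one with its canonical representative**: EVERY integer matrix `A` with `f(A) = 0` is
`GLₙ(ℤ)`-conjugate to the companion matrix `C_f` iff `ℤ[θ] = ℤ[X]/(f)` is a principal ideal ring (`⟸`: the ideal of
`A` is principal, §3; `⟹`: every nonzero ideal is the module of some matrix root of `f` — LATIMER–MACDUFFEE,
`exists_aeval_eq_zero_and_nonempty_linearEquiv` — hence principal by §3). [cite: Taussky1974, §1, p. 64]
[cite: Taussky1949, Theorems 1–4] [cite: EndoIwakiPajitnov2026, §3 Thm. 3.4] -/
theorem forall_exists_conj_companion_iff_isPrincipalIdealRing (hdeg : f.natDegree = n) :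
    (∀ (A : _root_.Matrix (Fin n) (Fin n) ℤ), aeval A f = 0 →
        ∃ P : _root_.Matrix (Fin n) (Fin n) ℤ, IsUnit P.det ∧ P * A = companion (fun i : Fin n ↦ f.coeff i) * P) ↔
      IsPrincipalIdealRing (AdjoinRoot f) := by
  have hC := aeval_companion_coeff_eq_zero (Fact.out : f.Monic) hdeg
  constructor
  · intro h
    refine ⟨fun J ↦ ?_⟩
    by_cases hJ : J = ⊥
    · rw [hJ]
      exact ⟨0, by simp⟩
    · obtain ⟨A, hA, ⟨e⟩⟩ := QuotModule.exists_aeval_eq_zero_and_nonempty_linearEquiv (f := f) hdeg hJ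
      exact (QuotModule.exists_conj_companion_iff_isPrincipal hdeg hC e).1 (h A hA)
  · intro hS A hA
    have hn : n ≠ 0 := hdeg ▸ natDegree_ne_zero_of_nontrivial (f := f)
    obtain ⟨J, -, ⟨e⟩⟩ := QuotModule.exists_linearEquiv_ideal (f := f) (A := A) (hA := hA) hdeg hn
    exact (QuotModule.exists_conj_companion_iff_isPrincipal hdeg hC e).2 (IsPrincipalIdealRing.principal J)

/-- The same for «integer matrices with characteristic polynomial `f`» (`χ_A = f ⟺ f(A) = 0` for `f` monic irreducible
of degree `n`, the tree's `aeval_eq_zero_iff_charpoly_eq`): they are ALL `GLₙ(ℤ)`-similar to the companion matrix of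
`f` iff `ℤ[θ]` is a principal ideal ring. [cite: Taussky1974, §1, p. 64] [cite: EndoIwakiPajitnov2026, §3 Thm. 3.2 and
Thm. 3.4] -/
theorem forall_charpoly_exists_conj_companion_iff_isPrincipalIdealRing (hdeg : f.natDegree = n) :
    (∀ A : _root_.Matrix (Fin n) (Fin n) ℤ, A.charpoly = f →
        ∃ P : _root_.Matrix (Fin n) (Fin n) ℤ, IsUnit P.det ∧ P * A = companion (fun i : Fin n ↦ f.coeff i) * P) ↔
      IsPrincipalIdealRing (AdjoinRoot f) := by
  have hn : n ≠ 0 := hdeg ▸ natDegree_ne_zero_of_nontrivial (f := f)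
  rw [← forall_exists_conj_companion_iff_isPrincipalIdealRing hdeg]
  exact forall_congr' fun A ↦ by rw [aeval_eq_zero_iff_charpoly_eq hdeg hn A]

/-- **In the class-number-one case every matrix root of `f` is conjugate to `C_f`** (the tree's
`exists_isUnit_det_and_mul_eq_mul_of_isPrincipalIdealRing` of `LatimerMacDuffee.lean`, with the companion matrix as
the canonical second matrix). [cite: Taussky1974, §1, p. 64] [cite: Taussky1949, Theorems 1–4] -/
theorem exists_conj_companion_of_isPrincipalIdealRing [IsPrincipalIdealRing (AdjoinRoot f)] (hdeg : f.natDegree = n)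
    {A : _root_.Matrix (Fin n) (Fin n) ℤ} (hA : aeval A f = 0) :
    ∃ P : _root_.Matrix (Fin n) (Fin n) ℤ, IsUnit P.det ∧ P * A = companion (fun i : Fin n ↦ f.coeff i) * P :=
  (forall_exists_conj_companion_iff_isPrincipalIdealRing hdeg).2 ‹_› A hA

end ClassNumberOne

end Literature.LinearAlgebra.Matrix
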